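import Literature.MathematicalPhysics.QuantumFieldTheory.Balaban1983to89.LatticeWordStokes
import Literature.MathematicalPhysics.QuantumFieldTheory.Balaban1983to89.B15DeterminingSets
import Literature.MathematicalPhysics.QuantumFieldTheory.Balaban1983to89.T3DescentFibreTower
import HarnessLib

/-!
# Route `UnitScaleTilt`, crux K1 «MinimiserStabilityRegPr» (stmt-QuantumFields-19200), registered stub `stub_prop7From14` (leaf V3 «Prop 7 from a
# background (14)») — **FLAT HOLONOMY TOOLKIT: a holonomy-flat configuration whose `k`-fold (0.4) average is trivial is PURE GAUGE INSIDE PRINT'S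
# GROUP (4)** (`u = 1` at the `k`-fold block centres)

Cell `ym3-torus` ∕ fleet seat `ym-ust-19200-p1` (gen 6).  Generic half (any `GaugeGroup`, any `Setup.Params`) of CARD-g5's «successor spec 0» — the
registered text of `stub_prop7From14` at the FLAT DATUM `V = 1` (carrier file: the sibling `…Prop7FlatDatum`).  «Holonomy-flat» (`hflat`): trivial
holonomy along every word of zero net displacement (from trivial plaquettes by `LatticeWordStokes.dist1_holAt_le`).  PROVED, sorry-free, no definitions:
§1–§2 dilated words `w ♭ t := w.flatMap (replicate t)` and the straight `L`-segments between block centres; §3 **STRAIGHT-TRANSPORTER TRANSFER** (no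
flatness): if `V(c) = U([emb c₋, emb c₊])` for all coarse `c` then `V(walk_y w) = U(walk_{emb y}(w ♭ L))` (`holAt_walk_of_straight`), `k`-fold
`holAt_walk_of_straightIter`, `walkEnd_embIter_flatMap`; §4 **THE (0.4) AVERAGE OF A HOLONOMY-FLAT CONFIGURATION IS ITS STRAIGHT TRANSPORTER AND STAYS
HOLONOMY-FLAT** (loop words closed, `netDisp_loopWord`; guard met; correction factor `ℰ(1,…,1) = 1` = hypothesis `hE`, the printed `exp[mean log]`:
`expMeanLogSU_E_one`): **`iter_blockAvg_eq_straightIter_of_flat`** `M^k(U)(c) = U([embIter_k c₋ → L^k steps e_c])`; §5 **TORUS-CLOSED WORDS**: equal net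
displacement ⇒ equal holonomy; trivial positive axis cycles at `x₀` ⇒ every word returning to `x₀` is trivial (winding compensated by whole cycles) ⇒
**`exists_gaugeAct_one_eq`** `U = 1^{u}`, `u(x)⁻¹ = U(x₀ → x)`; §6 **AT THE `k`-FOLD CENTRES** (`k ≤ m + K`, `N₀ = N_k·L^k`): trivial `k`-segments ⇒
trivial dilated coarse walks and axis cycles at centres ⇒ **`exists_gaugeAct_one_eq_of_segments`**: `U = 1^{u}` with `u ∘ embIter_k ≡ 1`, i.e. `u` in
[Balaban1985Variational]'s group (4) (`transfUp_eq_embIter`).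

References: T. Bałaban, CMP 102 (1985) 277–309 [Balaban1985Variational] ((4) p.278); CMP 109 (1987) 249–301 [Balaban1987RG1] ((0.1)–(0.4), (0.11)
pp.251–253); CMP 95 (1984) 17–40 [Balaban1984PropagatorsI] ((1.7) p.18); CMP 98 (1985) 17–51 [Balaban1985Averaging] ((8)–(12) pp.18–19);
I. Montvay, G. Münster, *Quantum fields on a lattice* (1994) (3.124)–(3.125) [MontvayMunster1994].
-/

noncomputable section

namespace Summit.QuantumFields.YangMills.Theorems.Prop7FlatHolonomy

open Literature.MathematicalPhysics.QuantumFieldTheory.Balaban1983to89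
open T4Continuum T4ReflectionCone BlockAveraging B15DeterminingSets

variable {P : Params} {j : ℕ} {G : Type*} [GaugeGroup G]

/-! ## §1 Dilated words `w ♭ t = w.flatMap (replicate t)` -/

section Words

variable {n : ℕ}

/-- Net displacement of a dilated word: `netDisp (w ♭ t) = t · netDisp w`. [folklore] -/
theorem netDisp_flatMap_replicate (t : ℕ) (κ : Fin n) : ∀ w : List (Letter n),
    netDisp (w.flatMap fun l => List.replicate t l) κ = t * netDisp w κ
  | [] => by simp [netDisp]
  | l :: w => by
    rw [List.flatMap_cons, netDisp_append, netDisp_replicate, netDisp_cons, netDisp_flatMap_replicate t κ w]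
    ring

/-- Dilating a run: `(l^a) ♭ t = l^{a·t}`. [folklore] -/
theorem flatMap_replicate_replicate (t : ℕ) (l : Letter n) : ∀ a : ℕ,
    (List.replicate a l).flatMap (fun l' => List.replicate t l') = List.replicate (a * t) l
  | 0 => by simp
  | a + 1 => by
    rw [List.replicate_succ, List.flatMap_cons, flatMap_replicate_replicate t l a, Nat.succ_mul, add_comm,
      List.replicate_add]

/-- Dilations compose: `(w ♭ s) ♭ t = w ♭ (s·t)`. [folklore] -/
theorem flatMap_flatMap_replicate (s t : ℕ) : ∀ w : List (Letter n),
    (w.flatMap fun l => List.replicate s l).flatMap (fun l => List.replicate t l) =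
      w.flatMap fun l => List.replicate (s * t) l
  | [] => by simp
  | l :: w => by
    rw [List.flatMap_cons, List.flatMap_cons, List.flatMap_append, flatMap_replicate_replicate,
      flatMap_flatMap_replicate s t w]

/-- The unit dilation is the identity: `w ♭ 1 = w`. [folklore] -/
theorem flatMap_replicate_one : ∀ w : List (Letter n), (w.flatMap fun l => List.replicate 1 l) = w
  | [] => by simp
  | l :: w => by rw [List.flatMap_cons, flatMap_replicate_one w]; rfl

end Words

/-! ## §2 Walks: concatenation, single steps, the straight segments between block centres -/

section Walks

/-- Holonomy along a concatenated walk. [folklore] -/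
theorem holAt_walk_append (U : GaugeField P j G) (x : Site P j) (w₁ w₂ : List (Letter P.d)) :
    holAt U (walk x (w₁ ++ w₂)) = holAt U (walk x w₁) * holAt U (walk (walkEnd x w₁) w₂) := by
  rw [walk_append, holAt_append]

/-- Holonomy of one forward step is the bond variable. [folklore] -/
theorem holAt_walk_single_true (U : GaugeField P j G) (x : Site P j) (μ : Fin P.d) :
    holAt U (walk x [(μ, true)]) = U ⟨x, μ⟩ := by
  simp [walk, holAt_cons, holAt_nil]

/-- `L` steps `−e_μ` from a block centre end at the previous block centre. [cite: Balaban1987RG1, (0.1) p.252] -/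
theorem walkEnd_replicate_L_false (y : Site P (j+1)) (μ : Fin P.d) :
    walkEnd (emb y) (List.replicate P.L (μ, false)) = emb (y.unshift μ) := by
  have h := walkEnd_walkEnd_wordRev (emb (y.unshift μ)) (List.replicate P.L (μ, true))
  rw [walkEnd_replicate_L, Site.shift_unshift, wordRev_replicate] at h
  exact h

/-- The backward straight segment has the inverse holonomy of the forward one. [cite: Balaban1984PropagatorsI, (1.7) p.18] -/
theorem holAt_walk_replicate_L_false (U : GaugeField P j G) (y : Site P (j+1)) (μ : Fin P.d) :
    holAt U (walk (emb y) (List.replicate P.L (μ, false))) =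
      (holAt U (walk (emb (y.unshift μ)) (List.replicate P.L (μ, true))))⁻¹ := by
  have h := holAt_walk_wordRev U (emb (y.unshift μ)) (List.replicate P.L (μ, true))
  rw [walkEnd_replicate_L, Site.shift_unshift, wordRev_replicate] at h
  exact h

/-- The end of a dilated walk from a block centre is the block centre of the end of the coarse walk. [cite: Balaban1987RG1, (0.1) p.252] -/
theorem walkEnd_emb_flatMap : ∀ (y : Site P (j+1)) (w : List (Letter P.d)),
    walkEnd (emb y) (w.flatMap fun l => List.replicate P.L l) = emb (walkEnd y w)
  | y, [] => by simp [walkEnd]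
  | y, (μ, true) :: w => by
    rw [List.flatMap_cons, walkEnd_append, walkEnd_replicate_L, walkEnd_emb_flatMap (y.shift μ) w]
    rfl
  | y, (μ, false) :: w => by
    rw [List.flatMap_cons, walkEnd_append, walkEnd_replicate_L_false, walkEnd_emb_flatMap (y.unshift μ) w]
    rfl

end Walks

/-! ## §3 The straight-transporter transfer (one step and `k`-fold) -/

section Transfer

/-- **ONE-STEP TRANSFER**: if `V(c)` is the straight transporter of `U` along `c` for every coarse bond `c`, then the holonomy of `V` along any
coarse walk is the holonomy of `U` along the `L`-dilated fine walk from the block centre. [cite: Balaban1984PropagatorsI, (1.7) p.18] -/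
theorem holAt_walk_of_straight (U : GaugeField P j G) (V : GaugeField P (j+1) G)
    (hV : ∀ c : PBond P (j+1), V c = holAt U (walk (emb c.src) (List.replicate P.L (c.dir, true)))) :
    ∀ (y : Site P (j+1)) (w : List (Letter P.d)),
      holAt V (walk y w) = holAt U (walk (emb y) (w.flatMap fun l => List.replicate P.L l))
  | y, [] => by simp [walk, holAt_nil]
  | y, (μ, true) :: w => by
    rw [List.flatMap_cons, holAt_walk_append, walkEnd_replicate_L, ← holAt_walk_of_straight U V hV (y.shift μ) w,
      ← hV ⟨y, μ⟩]
    simp [walk, holAt_cons]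
  | y, (μ, false) :: w => by
    rw [List.flatMap_cons, holAt_walk_append, walkEnd_replicate_L_false, holAt_walk_replicate_L_false,
      ← holAt_walk_of_straight U V hV (y.unshift μ) w, ← hV ⟨y.unshift μ, μ⟩]
    simp [walk, holAt_cons]

/-- **`k`-FOLD TRANSFER**: the holonomy of the `k`-fold straight-transporter field `c ↦ U([embIter_k c₋ → L^k steps e_c])` along a level-`k` walk is
the holonomy of `U` along the `L^k`-dilated walk from the `k`-fold centre. [cite: Balaban1987RG1, (0.1) p.252] -/
theorem holAt_walk_of_straightIter (U : GaugeField P 0 G) : ∀ (k : ℕ) (y : Site P k) (w : List (Letter P.d)),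
    holAt (fun c : PBond P k => holAt U (walk (embIter k c.src) (List.replicate (P.L ^ k) (c.dir, true)))) (walk y w) =
      holAt U (walk (embIter k y) (w.flatMap fun l => List.replicate (P.L ^ k) l))
  | 0, y, w => by
    have h1 : (fun c : PBond P 0 => holAt U (walk (embIter 0 c.src) (List.replicate (P.L ^ 0) (c.dir, true)))) = U := by
      funext c
      rw [pow_zero]
      exact holAt_walk_single_true U c.src c.dir
    rw [h1, pow_zero, flatMap_replicate_one]
    rfl
  | k + 1, y, w => by
    have hV : ∀ c : PBond P (k+1),
        (fun c : PBond P (k+1) => holAt U (walk (embIter (k+1) c.src) (List.replicate (P.L ^ (k+1)) (c.dir, true)))) c =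
          holAt (fun c' : PBond P k => holAt U (walk (embIter k c'.src) (List.replicate (P.L ^ k) (c'.dir, true))))
            (walk (emb c.src) (List.replicate P.L (c.dir, true))) := by
      intro c
      rw [holAt_walk_of_straightIter U k (emb c.src), flatMap_replicate_replicate, ← pow_succ']
      rfl
    rw [holAt_walk_of_straight _ _ hV y w, holAt_walk_of_straightIter U k (emb y), flatMap_flatMap_replicate, ← pow_succ']
    rfl

/-- The end of an `L^k`-dilated walk from a `k`-fold centre is the `k`-fold centre of the end of the coarse walk. [cite: Balaban1987RG1, (0.1) p.252] -/
theorem walkEnd_embIter_flatMap : ∀ (k : ℕ) (y : Site P k) (w : List (Letter P.d)),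
    walkEnd (embIter k y) (w.flatMap fun l => List.replicate (P.L ^ k) l) = embIter k (walkEnd y w)
  | 0, y, w => by rw [pow_zero, flatMap_replicate_one]; rfl
  | k + 1, y, w => by
    show walkEnd (embIter k (emb y)) _ = embIter k (emb (walkEnd y w))
    rw [← walkEnd_emb_flatMap, ← walkEnd_embIter_flatMap k, flatMap_flatMap_replicate, ← pow_succ']

end Transfer

/-! ## §4 The (0.4) average of a holonomy-flat configuration -/

section FlatAverage

variable (ℰ : LoopAverage G)

/-- The (0.4) loop variables of a holonomy-flat configuration are trivial (the loop words are closed, `netDisp_loopWord`).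
[cite: Balaban1987RG1, (0.4) p.253] -/
theorem loopHol_eq_one_of_flat (U : GaugeField P j G)
    (hflat : ∀ (x : Site P j) (w : List (Letter P.d)), (∀ ν, netDisp w ν = 0) → holAt U (walk x w) = 1)
    (c : PBond P (j+1)) (i : BlockAveraging.Idx P) : loopHol U c i = 1 :=
  hflat _ _ (netDisp_loopWord _ _ _ _ _)

/-- Hence the small-field guard of (0.4) is met. [cite: Balaban1987RG1, (0.4) p.253] -/
theorem small_of_flat (U : GaugeField P j G)
    (hflat : ∀ (x : Site P j) (w : List (Letter P.d)), (∀ ν, netDisp w ν = 0) → holAt U (walk x w) = 1)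
    (c : PBond P (j+1)) : Small ℰ U c := fun i => by
  rw [loopHol_eq_one_of_flat U hflat c i, GaugeGroup.dist1_one]
  exact ℰ.δ_pos

/-- Hence the correction factor of (0.4) is `ℰ(1,…,1) = 1`. [cite: Balaban1987RG1, (0.4) p.253] -/
theorem corr_eq_one_of_flat (hE : ∀ n : ℕ, ℰ.E (fun _ : Fin (n + 1) => (1 : G)) = 1) (U : GaugeField P j G)
    (hflat : ∀ (x : Site P j) (w : List (Letter P.d)), (∀ ν, netDisp w ν = 0) → holAt U (walk x w) = 1)
    (c : PBond P (j+1)) : corr ℰ U c = 1 := by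
  unfold corr
  rw [if_pos (small_of_flat ℰ U hflat c)]
  have h : loopHol U c = fun _ => 1 := funext (loopHol_eq_one_of_flat U hflat c)
  rw [h]
  exact hE _

/-- **THE (0.4) AVERAGE OF A HOLONOMY-FLAT CONFIGURATION IS ITS STRAIGHT TRANSPORTER** `Ū(c) = U([emb c₋, emb c₊])`.
[cite: Balaban1987RG1, (0.4) p.253] -/
theorem avgFun_apply_of_flat (hE : ∀ n : ℕ, ℰ.E (fun _ : Fin (n + 1) => (1 : G)) = 1) (U : GaugeField P j G)
    (hflat : ∀ (x : Site P j) (w : List (Letter P.d)), (∀ ν, netDisp w ν = 0) → holAt U (walk x w) = 1)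
    (c : PBond P (j+1)) : avgFun ℰ U c = holAt U (walk (emb c.src) (List.replicate P.L (c.dir, true))) := by
  show corr ℰ U c * AveragingRT.axialAvg U c = _
  rw [corr_eq_one_of_flat ℰ hE U hflat c, one_mul, axialAvg_eq_holAt_walk]

/-- The `k`-fold straight-transporter field of a holonomy-flat configuration is holonomy-flat. [cite: Balaban1987RG1, (0.1) p.252] -/
theorem flat_straightIter (U : GaugeField P 0 G)
    (hflat : ∀ (x : Site P 0) (w : List (Letter P.d)), (∀ ν, netDisp w ν = 0) → holAt U (walk x w) = 1) (k : ℕ) :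
    ∀ (y : Site P k) (w : List (Letter P.d)), (∀ ν, netDisp w ν = 0) →
      holAt (fun c : PBond P k => holAt U (walk (embIter k c.src) (List.replicate (P.L ^ k) (c.dir, true)))) (walk y w) = 1 := by
  intro y w hw
  rw [holAt_walk_of_straightIter]
  exact hflat _ _ fun ν => by rw [netDisp_flatMap_replicate, hw ν, mul_zero]

/-- **THE `k`-FOLD (0.4) AVERAGE OF A HOLONOMY-FLAT CONFIGURATION**: `M^k(U)(c) = U([embIter_k c₋ → L^k steps e_c])` — the straight transporter
between neighbouring `k`-fold block centres — for every small-loop average with `ℰ(1,…,1) = 1`. [cite: Balaban1987RG1, (0.11) p.253] -/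
theorem iter_blockAvg_eq_straightIter_of_flat (hE : ∀ n : ℕ, ℰ.E (fun _ : Fin (n + 1) => (1 : G)) = 1) (U : GaugeField P 0 G)
    (hflat : ∀ (x : Site P 0) (w : List (Letter P.d)), (∀ ν, netDisp w ν = 0) → holAt U (walk x w) = 1) : ∀ k : ℕ,
    Averaging.iter (fun i => blockAvg (P := P) (j := i) ℰ) k U =
      fun c : PBond P k => holAt U (walk (embIter k c.src) (List.replicate (P.L ^ k) (c.dir, true)))
  | 0 => by
    funext c
    rw [pow_zero]
    exact (holAt_walk_single_true U c.src c.dir).symm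
  | k + 1 => by
    show avgFun ℰ (Averaging.iter (fun i => blockAvg (P := P) (j := i) ℰ) k U) = _
    rw [iter_blockAvg_eq_straightIter_of_flat hE U hflat k]
    funext c
    rw [avgFun_apply_of_flat ℰ hE _ (flat_straightIter U hflat k) c, holAt_walk_of_straightIter, flatMap_replicate_replicate,
      ← pow_succ']
    rfl

end FlatAverage

/-! ## §5 Torus-closed words and the pure-gauge representation -/

section Torus

variable (U : GaugeField P j G)
  (hflat : ∀ (x : Site P j) (w : List (Letter P.d)), (∀ ν, netDisp w ν = 0) → holAt U (walk x w) = 1)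
include hflat

omit hflat in
/-- A run of whole multiples of the period returns to its base. [folklore] -/
theorem walkEnd_replicate_mul_sitesPerDir (x₀ : Site P j) (l : Letter P.d) (a : ℕ) :
    walkEnd x₀ (List.replicate (a * P.sitesPerDir j) l) = x₀ :=
  walkEnd_eq_self_of_netDisp fun κ => by
    rw [netDisp_replicate]; push_cast; rw [ZMod.natCast_self]; ring

omit hflat in
/-- If the positive axis cycle at `x₀` in direction `ν` has trivial holonomy, so has every run of whole multiples of the period, in either
orientation. [folklore] -/
theorem holAt_walk_replicate_mul_sitesPerDir (x₀ : Site P j) (ν : Fin P.d)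
    (hcyc : holAt U (walk x₀ (List.replicate (P.sitesPerDir j) (ν, true))) = 1) :
    ∀ (b : Bool) (a : ℕ), holAt U (walk x₀ (List.replicate (a * P.sitesPerDir j) (ν, b))) = 1 := by
  -- one cycle of either orientation (the negative one is the positive one backwards)
  have hone : ∀ b : Bool, holAt U (walk x₀ (List.replicate (P.sitesPerDir j) (ν, b))) = 1 := by
    have h := holAt_walk_wordRev U x₀ (List.replicate (P.sitesPerDir j) (ν, true))
    have hend := walkEnd_replicate_mul_sitesPerDir x₀ (ν, true) 1
    rw [one_mul] at hend
    rw [hend, wordRev_replicate, hcyc, inv_one] at h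
    rintro ⟨_ | _⟩ <;> assumption
  intro b a
  induction a with
  | zero => simp [walk, holAt_nil]
  | succ a ih =>
    rw [Nat.succ_mul, List.replicate_add, holAt_walk_append, walkEnd_replicate_mul_sitesPerDir, ih, hone, mul_one]

/-- **EVERY TORUS-CLOSED WORD AT `x₀` HAS TRIVIAL HOLONOMY** once the configuration is holonomy-flat and the `d` positive axis cycles at `x₀` are
trivial: the winding `netDisp w = N_j·m` is compensated by whole cycles (a staircase word of runs `N_j·|m_ν|`), after which the word has zero net
displacement. [folklore] -/
theorem holAt_walk_eq_one_of_walkEnd_eq (x₀ : Site P j)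
    (hcyc : ∀ ν, holAt U (walk x₀ (List.replicate (P.sitesPerDir j) (ν, true))) = 1)
    (w : List (Letter P.d)) (hw : walkEnd x₀ w = x₀) : holAt U (walk x₀ w) = 1 := by
  -- the winding numbers
  have hdvd : ∀ ν, (P.sitesPerDir j : ℤ) ∣ netDisp w ν := fun ν => by
    have h := congrFun hw ν
    rw [walkEnd_apply] at h
    exact (ZMod.intCast_zmod_eq_zero_iff_dvd _ _).mp (add_eq_left.mp h)
  choose m hm using hdvd
  -- the compensating staircase of whole cycles has trivial holonomy and returns to `x₀`
  have hruns : ∀ as : List (Fin P.d),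
      holAt U (walk x₀ (stairRuns (fun ν => -netDisp w ν) as)) = 1 ∧ walkEnd x₀ (stairRuns (fun ν => -netDisp w ν) as) = x₀ := by
    intro as
    induction as with
    | nil => exact ⟨by simp [stairRuns, walk, holAt_nil], rfl⟩
    | cons a as ih =>
      have hrun : axisRun a (-netDisp w a) = List.replicate ((m a).natAbs * P.sitesPerDir j) (a, decide (0 ≤ -netDisp w a)) := by
        rw [axisRun, hm a, Int.natAbs_neg, Int.natAbs_mul, Int.natAbs_natCast, Nat.mul_comm]
      rw [stairRuns, hrun]
      refine ⟨?_, ?_⟩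
      · rw [holAt_walk_append, walkEnd_replicate_mul_sitesPerDir, ih.1, mul_one]
        exact holAt_walk_replicate_mul_sitesPerDir U x₀ a (hcyc a) _ _
      · rw [walkEnd_append, walkEnd_replicate_mul_sitesPerDir, ih.2]
  have hC := hruns ((List.finRange P.d).map (1 : Equiv.Perm (Fin P.d)))
  -- `w` followed by the compensating word has zero net displacement
  have hzero : holAt U (walk x₀ (w ++ stairWord 1 (fun ν => -netDisp w ν))) = 1 :=
    hflat x₀ _ fun ν => by rw [netDisp_append, netDisp_stairWord, add_neg_cancel]
  rw [holAt_walk_append, hw, stairWord, hC.1, mul_one] at hzero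
  exact hzero

/-- Two words from `x₀` with the same END SITE (on the torus) have the same holonomy. [folklore] -/
theorem holAt_walk_eq_of_walkEnd_eq (x₀ : Site P j)
    (hcyc : ∀ ν, holAt U (walk x₀ (List.replicate (P.sitesPerDir j) (ν, true))) = 1)
    {w₁ w₂ : List (Letter P.d)} (h : walkEnd x₀ w₁ = walkEnd x₀ w₂) : holAt U (walk x₀ w₁) = holAt U (walk x₀ w₂) := by
  have h1 := holAt_walk_eq_one_of_walkEnd_eq U hflat x₀ hcyc (w₁ ++ wordRev w₂)
    (by rw [walkEnd_append, h, walkEnd_walkEnd_wordRev])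
  rw [holAt_walk_append, h, holAt_walk_wordRev] at h1
  exact mul_inv_eq_one.mp h1

omit hflat in
/-- Every site is the end of a (staircase) walk from `x₀`. [folklore] -/
theorem walkEnd_stairWord_sub (x₀ x : Site P j) :
    walkEnd x₀ (stairWord 1 fun ν => (((x ν - x₀ ν).val : ℕ) : ℤ)) = x := by
  funext ν
  rw [walkEnd_apply, netDisp_stairWord, Int.cast_natCast, ZMod.natCast_zmod_val, add_sub_cancel]

/-- **PURE GAUGE**: a holonomy-flat configuration whose `d` positive axis cycles at `x₀` are trivial is the gauge transform of the trivial
configuration by `u(x) = U(x₀ → x)⁻¹` (any walk; well defined by `holAt_walk_eq_of_walkEnd_eq`) — the lattice form of «a flat connection with trivial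
holonomies is pure gauge» (tree gauge, [MontvayMunster1994] (3.124)–(3.125)). [cite: MontvayMunster1994, (3.124)-(3.125) p.120] -/
theorem exists_gaugeAct_one_eq (x₀ : Site P j)
    (hcyc : ∀ ν, holAt U (walk x₀ (List.replicate (P.sitesPerDir j) (ν, true))) = 1) :
    ∃ u : GaugeTransf P j G, GaugeField.gaugeAct u 1 = U ∧
      ∀ (x : Site P j) (w : List (Letter P.d)), walkEnd x₀ w = x → u x = (holAt U (walk x₀ w))⁻¹ := by
  -- a choice of walk `x₀ → x` for every site
  obtain ⟨pw, hpw⟩ : ∃ pw : Site P j → List (Letter P.d), ∀ x, walkEnd x₀ (pw x) = x :=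
    ⟨fun x => stairWord 1 fun ν => (((x ν - x₀ ν).val : ℕ) : ℤ), walkEnd_stairWord_sub x₀⟩
  have hindep : ∀ (x : Site P j) (w : List (Letter P.d)), walkEnd x₀ w = x →
      holAt U (walk x₀ (pw x)) = holAt U (walk x₀ w) := fun x w hw =>
    holAt_walk_eq_of_walkEnd_eq U hflat x₀ hcyc (by rw [hpw, hw])
  refine ⟨fun x => (holAt U (walk x₀ (pw x)))⁻¹, ?_, fun x w hw => ?_⟩
  · funext b
    show (holAt U (walk x₀ (pw b.src)))⁻¹ * 1 * ((holAt U (walk x₀ (pw b.tgt)))⁻¹)⁻¹ = U b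
    rw [mul_one, inv_inv, hindep b.tgt (pw b.src ++ [(b.dir, true)]) (by rw [walkEnd_append, hpw]; rfl),
      holAt_walk_append, hpw, holAt_walk_single_true, inv_mul_cancel_left]
  · show (holAt U (walk x₀ (pw x)))⁻¹ = _
    rw [hindep x w hw]

end Torus

/-! ## §6 At the `k`-fold block centres: trivial segments ⇒ pure gauge inside the group (4) -/

section Centres

/-- In the standing range the finest torus has `L^k` times as many sites per direction as the `k`-th one. [cite: Balaban1987RG1, (0.1) p.251] -/
theorem sitesPerDir_zero_eq_mul_pow : ∀ {k : ℕ}, k ≤ P.m + P.K → P.sitesPerDir 0 = P.sitesPerDir k * P.L ^ k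
  | 0, _ => by rw [pow_zero, mul_one]
  | k + 1, hk => by
    rw [sitesPerDir_zero_eq_mul_pow (Nat.le_of_succ_le hk), P.sitesPerDir_eq_mul_succ hk, pow_succ]
    ring

omit [GaugeGroup G] in
/-- `T4Continuum.transfUp u k = u ∘ embIter k` (the restriction of a gauge transformation up the block centres). [cite: Balaban1985Averaging, (12) p.19] -/
theorem transfUp_eq_embIter (u : GaugeTransf P 0 G) : ∀ (k : ℕ) (y : Site P k), transfUp u k y = u (embIter k y)
  | 0, _ => rfl
  | k + 1, y => transfUp_eq_embIter u k (emb y)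

variable (U : GaugeField P 0 G) {k : ℕ}
  (hseg : ∀ c : PBond P k, holAt U (walk (embIter k c.src) (List.replicate (P.L ^ k) (c.dir, true))) = 1)
include hseg

/-- If every `k`-fold straight segment between neighbouring `k`-centres is trivial, every `L^k`-dilated coarse walk from a `k`-centre has trivial
holonomy. [cite: Balaban1987RG1, (0.1) p.252] -/
theorem holAt_walk_embIter_flatMap_eq_one (y : Site P k) (w : List (Letter P.d)) :
    holAt U (walk (embIter k y) (w.flatMap fun l => List.replicate (P.L ^ k) l)) = 1 := by
  rw [← holAt_walk_of_straightIter U k y w]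
  have h : (fun c : PBond P k => holAt U (walk (embIter k c.src) (List.replicate (P.L ^ k) (c.dir, true)))) =
      (1 : GaugeField P k G) := funext hseg
  rw [h]
  exact T3DescentFibreTower.holAt_one _

/-- … in particular the `d` positive axis cycles of the finest torus at a `k`-centre (standing range: `N₀ = N_k·L^k`). [cite: Balaban1987RG1, (0.1) p.251] -/
theorem holAt_walk_cycle_embIter_eq_one (hk : k ≤ P.m + P.K) (y : Site P k) (ν : Fin P.d) :
    holAt U (walk (embIter k y) (List.replicate (P.sitesPerDir 0) (ν, true))) = 1 := by
  rw [sitesPerDir_zero_eq_mul_pow hk, ← flatMap_replicate_replicate]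
  exact holAt_walk_embIter_flatMap_eq_one U hseg y _

/-- **PURE GAUGE INSIDE THE GROUP (4)**: a holonomy-flat configuration of the finest torus all of whose `k`-fold straight segments between
neighbouring `k`-centres are trivial is `1^{u}` for a gauge transformation `u` with `u = 1` at every `k`-fold block centre ([Balaban1985Variational]
(4): «u(y) = 1 for y ∈ 𝔅_k»). [cite: Balaban1985Variational, (4) p.278] -/
theorem exists_gaugeAct_one_eq_of_segments (hk : k ≤ P.m + P.K)
    (hflat : ∀ (x : Site P 0) (w : List (Letter P.d)), (∀ ν, netDisp w ν = 0) → holAt U (walk x w) = 1) :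
    ∃ u : GaugeTransf P 0 G, (∀ y : Site P k, u (embIter k y) = 1) ∧ GaugeField.gaugeAct u 1 = U := by
  obtain ⟨u, hu, huw⟩ := exists_gaugeAct_one_eq U hflat (embIter k (0 : Site P k))
    (holAt_walk_cycle_embIter_eq_one U hseg hk 0)
  refine ⟨u, fun y => ?_, hu⟩
  rw [huw (embIter k y) ((stairWord 1 fun ν => (((y ν - (0 : Site P k) ν).val : ℕ) : ℤ)).flatMap fun l => List.replicate (P.L ^ k) l)
    (by rw [walkEnd_embIter_flatMap, walkEnd_stairWord_sub]), holAt_walk_embIter_flatMap_eq_one U hseg, inv_one]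

end Centres

end Summit.QuantumFields.YangMills.Theorems.Prop7FlatHolonomy

end
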